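import Literature.IUT.HodgeArakelov.BadPrimeGaussianMonoidsProofs4
import HarnessLib

/-!
# [IUTchII] Cor 3.6 (ii)/(iii): remaining junction theorems of SUB-DAG `SUBDAG-IUTchII-Cor-36` —
# Galois stability of `Ψ_{F_ξ}` by transport, the `Ψ_{2l·ξ}`-compatibility, the `∞`-splitting identity,
# the labeled diagonal, and «isomorphisms respect splittings up to torsion» (proof-only companion no. 5)

S. Mochizuki, *Inter-universal Teichmüller theory II*, §3, kurims Dec-2020 manuscript, Cor 3.6 pp. 99–101
(IUTchII §3 Cor 3.6, kurims pp.99–101) [claim: Mochizuki2012, status: disputed] (D-0012 claim key; nothing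
disputed is asserted here — every theorem below is elementary monoid algebra over the REAL objects of
abc-iut-L6-t2's `BadPrimeGaussianMonoids.lean` / `TemperedThetaMonoids.lean` / `GaussianMonoidsGood.lean`).
abc-iut cell, D-0068 sub-DAG `plan/L6/SUBDAG-IUTchII-Cor-36.md` (SUBDAG-WANTED (L6) v1 row W6-S8), seat
abc-iut-w5-d192; PROOF-ONLY companion of `BadPrimeGaussianMonoids.lean` after abc-iut-w4-d004's
`…Proofs2/3/4`, `…SyncProofs` and abc-iut-w5-d031's `…InftyRestrictionProofs` (which cover the Kummer ∘
restriction ∘ transport composites of Cor 3.6 (ii) and the unit/theta factors of (iii)); the membership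
lemmas `theta_mem_thetaSplit` / `mem_thetaSplit_of_mem_units` of `…Proofs4` are reused by import. NO definition, NO
`Prop` fact; hypotheses are stated inline in Mathlib vocabulary. All print references below are PARAPHRASES
with page/line locators on the writer's render (paper:url-5036b4059555), not quotations.

What is PROVED (sub-DAG rows in brackets):
* [Cor-36.ii.r9] `piIso_equivariant`, `map_piIso_comap_eq_of_equivariant`,
  `frobenioidGaussianMonoid_diagonalStable_of_equivariant`, `inftyFrobenioidGaussianMonoid_diagonalStable_of_equivariant`
  — p.100 l.23–26 (each `Ψ_{F_ξ}(†F_v)` carries a natural action of `G_v(M^Θ_*)_{⟨F_l^⋇⟩}`): if the Kummer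
  isomorphism `e : Ψ_{†C_v} ⥲ Ψ_cns(M^Θ_*)` intertwines a `G`-action `γ` on `Ψ_{†C_v}` with a `G`-action `β` on `Ψ_cns`
  (Prop 3.3 (ii)'s compatibility with the conjugation actions — the inline hypothesis `hequiv`; its
  construction is GAP-LEDGER G-w4d019-1) and `Ψ_ξ` is stable under the diagonal `β`-action (abc-iut-w4-d004
  `map_pi_diagonalStable` / `map_pi_diagonalStable_of_kummer_of_fixed`), then `Ψ_{F_ξ} = (piIso e)⁻¹(Ψ_ξ)` is
  stable under the diagonal `γ`-action; likewise for every transported submonoid (the `∞`-version).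
* [Cor-36.ii.r12] `comap_piIso_gaussianMonoid2l`, `frobenioidGaussianMonoid2l_eq` — p.100 l.67–68 (compatibility
  with the equalities of submonoids involving `Ψ_{2l·ξ}`): the transported `Ψ_{2l·ξ}` is
  `(Ψ^×_{†C_v})_{⟨F_l^⋇⟩} · Im(ξ)^{2l·ℕ}` and is independent of the value-profile `ξ`.
* [Cor-36.iii.r14/r15] `piIso_diagonalEmbedding`, `diagonalEmbedding_equivariant` — p.100 l.90–98 (the
  diagonal `(Ψ_{†C_v})_{⟨|F_l|⟩}` is the graph of an isomorphism `(Ψ_{†C_v})_0 ⥲ (Ψ_{†C_v})_{⟨F_l^⋇⟩}` compatible with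
  the labeled actions): the diagonal embedding commutes with the Kummer copies and intertwines an
  automorphism at label `0` with the diagonal automorphism.
* [Cor-36.iii.r17] `inftyFrobenioidGaussianMonoid_eq` — p.100 l.105–108: `∞Ψ_{F_ξ}(†F_v) = (Ψ^×_{†C_v})_{⟨F_l^⋇⟩} ·
  Im(ξ)^{ℚ≥0}` for abc-iut-L6-t2's `rootPowers` reading of `ξ^{ℚ≥0}` (documented slack B6 inherited; the
  printed-exact reading relative to restriction data is abc-iut-w5-d031's `mrange_pi_eq_inftyArising`).
* [Cor-36.iii.r19] `isUnit_splitMonoid_iff`, `splitMonoid_mulEquiv_mem_units_iff`,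
  `splitMonoid_mulEquiv_generator` — p.100 l.110 – p.101 l.3 (the splittings are compatible, relative to
  the isomorphisms of the third display, with the splittings up to torsion of Prop 3.1 (i), Prop 3.3,
  Cor 3.5 (iii)): ANY monoid isomorphism `U·θ^ℕ ⥲ U′·θ′^ℕ` between split monoids whose generators have
  infinite order modulo the unit groups carries `U` onto `U′` and `θ` into `U′·θ′` — so the Kummer
  isomorphism `kummerTheta α` of Prop 3.3 (i) respects the splittings up to torsion automatically (the
  infinite-order hypothesis holds at the model, where the theta value has positive valuation).
HONEST FRAMING: elementary algebra; nothing here bears on [IUTchIII] Cor. 3.12; no side taken; typed ≠ endorsed.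
-/

namespace Literature.IUT.HodgeArakelov

namespace BadPrimeGaussianMonoids

open TemperedThetaMonoids

universe u v w

/-! ### 1. [Cor-36.ii.r9] Galois stability of the Frobenioid-theoretic Gaussian monoids by transport -/

section Transport

variable {T : Type u} {M : Type v} [CommMonoid M] {N : Type w} [CommMonoid N]
  {G : Type*} [Group G] (γ : G →* MulAut N) (β : G →* MulAut M) (e : N ≃* M)

/-- The labeled Kummer copies `piIso T e` intertwine the two DIAGONAL actions as soon as the single Kummer
isomorphism `e` intertwines the actions (Cor 3.6 (i), the compatibility «↷» of p.99 l.40–47, paraphrase).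
(IUTchII §3 Cor 3.6 (i), kurims p.99) [claim: Mochizuki2012, status: disputed] -/
theorem piIso_equivariant (hequiv : ∀ (g : G) (n : N), e (γ g n) = β g (e n)) (g : G) (x : T → N) :
    piIso T e (piIso T (γ g) x) = piIso T (β g) (piIso T e x) := by
  funext t
  exact hequiv g (x t)

/-- **Transport of diagonal stability**, generic form (Cor 3.6 (ii), p.100 l.23–26, paraphrase: each
`Ψ_{F_ξ}(†F_v)` is equipped with a natural action by `G_v(M^Θ_*)_{⟨F_l^⋇⟩}`): if `e` is `G`-equivariant and a
submonoid `S ⊆ ∏_{|t|} Ψ_cns,|t|` is stable under the diagonal action, then its pull-back along the Kummer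
copies is stable under the diagonal action on `∏_{|t|} (Ψ_{†C_v})_{|t|}`.
(IUTchII §3 Cor 3.6 (ii), kurims p.100) [claim: Mochizuki2012, status: disputed] -/
theorem map_piIso_comap_eq_of_equivariant (hequiv : ∀ (g : G) (n : N), e (γ g n) = β g (e n))
    (S : Submonoid (T → M)) (hS : ∀ (g : G) (y : T → M), y ∈ S → piIso T (β g) y ∈ S) (g : G) :
    (S.comap (piIso T e).toMonoidHom).map (piIso T (γ g)).toMonoidHom = S.comap (piIso T e).toMonoidHom := by
  apply le_antisymm
  · rintro _ ⟨x, hx, rfl⟩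
    change piIso T e x ∈ S at hx
    change piIso T e (piIso T (γ g) x) ∈ S
    rw [piIso_equivariant γ β e hequiv]
    exact hS g _ hx
  · intro x hx
    change piIso T e x ∈ S at hx
    refine ⟨piIso T (γ g⁻¹) x, ?_, ?_⟩
    · change piIso T e (piIso T (γ g⁻¹) x) ∈ S
      rw [piIso_equivariant γ β e hequiv]
      exact hS g⁻¹ _ hx
    · change piIso T (γ g) (piIso T (γ g⁻¹) x) = x
      funext t
      change (γ g) ((γ g⁻¹) (x t)) = x t
      rw [map_inv, MulAut.inv_apply]
      exact (γ g).apply_symm_apply (x t)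

/-- From a `map`-equality form of stability (as proved by abc-iut-w4-d004's `map_pi_diagonalStable`) to the
pointwise form used above. (IUTchII §3 Cor 3.5 (ii), kurims p.95) [claim: Mochizuki2012, status: disputed] -/
theorem mem_of_map_piIso_eq {S : Submonoid (T → M)} {φ : M ≃* M}
    (h : S.map (piIso T φ).toMonoidHom = S) {y : T → M} (hy : y ∈ S) : piIso T φ y ∈ S := by
  rw [← h]
  exact ⟨y, hy, rfl⟩

/-- **[Cor-36.ii.r9]** (Cor 3.6 (ii), p.100 l.23–26, paraphrase: each `Ψ_{F_ξ}(†F_v)` is equipped with a natural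
action by `G_v(M^Θ_*)_{⟨F_l^⋇⟩}`): the Frobenioid-theoretic Gaussian monoid is stable under the diagonal
`G`-action on `∏_{|t|} (Ψ_{†C_v})_{|t|}`, GIVEN that the Kummer isomorphism `e` is `G`-equivariant (Prop 3.3
(ii); construction = GAP-LEDGER G-w4d019-1) and that `Ψ_ξ` is stable under the diagonal `G`-action (Cor
3.5 (ii), abc-iut-w4-d004 `map_pi_diagonalStable(_of_kummer_of_fixed)`).
(IUTchII §3 Cor 3.6 (ii), kurims p.100) [claim: Mochizuki2012, status: disputed] -/
theorem frobenioidGaussianMonoid_diagonalStable_of_equivariant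
    (hequiv : ∀ (g : G) (n : N), e (γ g n) = β g (e n)) (ξ : T → M)
    (hS : ∀ (g : G) (y : T → M), y ∈ gaussianMonoid ξ → piIso T (β g) y ∈ gaussianMonoid ξ) (g : G) :
    (frobenioidGaussianMonoid e ξ).map (piIso T (γ g)).toMonoidHom = frobenioidGaussianMonoid e ξ :=
  map_piIso_comap_eq_of_equivariant γ β e hequiv (gaussianMonoid ξ) hS g

/-- **[Cor-36.ii.r9]**, `∞`-version for abc-iut-L6-t2's `∞Ψ_{F_ξ}` (same hypotheses with `∞Ψ_ξ`).
(IUTchII §3 Cor 3.6 (ii), kurims p.100) [claim: Mochizuki2012, status: disputed] -/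
theorem inftyFrobenioidGaussianMonoid_diagonalStable_of_equivariant
    (hequiv : ∀ (g : G) (n : N), e (γ g n) = β g (e n)) (ξ : T → M)
    (hS : ∀ (g : G) (y : T → M), y ∈ inftyGaussianMonoid ξ → piIso T (β g) y ∈ inftyGaussianMonoid ξ)
    (g : G) :
    (inftyFrobenioidGaussianMonoid e ξ).map (piIso T (γ g)).toMonoidHom = inftyFrobenioidGaussianMonoid e ξ :=
  map_piIso_comap_eq_of_equivariant γ β e hequiv (inftyGaussianMonoid ξ) hS g

end Transport

/-! ### 2. [Cor-36.ii.r12] Compatibility with the `ξ`-independent submonoids `Ψ_{2l·ξ}` -/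

section TwoL

variable {T : Type u} {M : Type v} [CommMonoid M] {N : Type w} [CommMonoid N]

/-- **[Cor-36.ii.r12]** (Cor 3.6 (ii), p.100 l.67–68, paraphrase: compatible with the equalities of
submonoids involving `Ψ_{2l·ξ}`): the pull-back of `Ψ_{2l·ξ} = Ψ^×_{⟨F_l^⋇⟩} · ξ^{2l·ℕ}` along the Kummer copies is
`(Ψ^×_{†C_v})_{⟨F_l^⋇⟩} · Im(ξ)^{2l·ℕ}`, `Im(ξ) = e⁻¹ ∘ ξ`. (IUTchII §3 Cor 3.6 (ii), kurims p.100) [claim: Mochizuki2012, status: disputed] -/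
theorem comap_piIso_gaussianMonoid2l (twoL : ℕ) (e : N ≃* M) (ξ : T → M) :
    (gaussianMonoid2l twoL ξ).comap (piIso T e).toMonoidHom = gaussianMonoid2l twoL (fun t => e.symm (ξ t)) := by
  have hpow : (fun t => e.symm ((ξ ^ twoL) t)) = (fun t => e.symm (ξ t)) ^ twoL := by
    funext t
    simp only [Pi.pow_apply, map_pow]
  change frobenioidGaussianMonoid e (ξ ^ twoL) = gaussianMonoid ((fun t => e.symm (ξ t)) ^ twoL)
  rw [frobenioidGaussianMonoid_eq, hpow]

/-- **[Cor-36.ii.r12]**: the transported `Ψ_{2l·ξ}` is independent of the value-profile `ξ` (transport of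
abc-iut-L6-t2's `ValueProfileData.gaussianMonoid2l_eq`). (IUTchII §3 Cor 3.6 (ii), kurims p.100) [claim: Mochizuki2012, status: disputed] -/
theorem frobenioidGaussianMonoid2l_eq [DecidableEq T] [Fintype T] {twoL : ℕ}
    (D : ValueProfileData T M twoL) (e : N ≃* M) {ξ₁ ξ₂ : T → M}
    (h₁ : ξ₁ ∈ D.valueProfiles) (h₂ : ξ₂ ∈ D.valueProfiles) :
    gaussianMonoid2l twoL (fun t => e.symm (ξ₁ t)) = gaussianMonoid2l twoL (fun t => e.symm (ξ₂ t)) := by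
  rw [← comap_piIso_gaussianMonoid2l, ← comap_piIso_gaussianMonoid2l, D.gaussianMonoid2l_eq h₁ h₂]

end TwoL

/-! ### 3. [Cor-36.iii.r14/r15] The labeled diagonal of the Frobenioid-theoretic constants -/

section Diagonal

variable {T : Type u} {M : Type v} [CommMonoid M] {N : Type w} [CommMonoid N]

/-- **[Cor-36.iii.r14]** (Cor 3.6 (iii), p.100 l.90–97, paraphrase: the diagonal `(Ψ_{†C_v})_{⟨|F_l|⟩}` is the graph
of an isomorphism `(Ψ_{†C_v})_0 ⥲ (Ψ_{†C_v})_{⟨F_l^⋇⟩}`): the diagonal embedding (abc-iut-L6-t2's `diagonalEmbedding`,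
whose range is the diagonal, `mrange_diagonalEmbedding`) commutes with the labeled Kummer copies of (i).
(IUTchII §3 Cor 3.6 (iii), kurims p.100) [claim: Mochizuki2012, status: disputed] -/
theorem piIso_diagonalEmbedding (e : N ≃* M) (n : N) :
    piIso T e (diagonalEmbedding T N n) = diagonalEmbedding T M (e n) := rfl

/-- **[Cor-36.iii.r15]** (Cor 3.6 (iii), p.100 l.98, paraphrase: compatible with the respective labeled
`G_v(M^Θ_*)`-actions): the diagonal embedding intertwines an automorphism of the `0`-labeled copy with the
corresponding DIAGONAL automorphism of `∏_{|t|} (Ψ_{†C_v})_{|t|}`.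
(IUTchII §3 Cor 3.6 (iii), kurims p.100) [claim: Mochizuki2012, status: disputed] -/
theorem diagonalEmbedding_equivariant (φ : N ≃* N) (n : N) :
    diagonalEmbedding T N (φ n) = piIso T φ (diagonalEmbedding T N n) := rfl

end Diagonal

/-! ### 4. [Cor-36.iii.r17] The `∞`-splitting identity `∞Ψ_{F_ξ} = (Ψ^×_{†C_v})_{⟨F_l^⋇⟩} · Im(ξ)^{ℚ≥0}` -/

section Infty

variable {T : Type u} {M : Type v} [CommMonoid M] {N : Type w} [CommMonoid N]

/-- Pull-back along a multiplicative equivalence is push-forward along its inverse (Mathlib's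
`Submonoid.comap_equiv_eq_map_symm` in the `toMonoidHom` spelling used by the statement file). [folklore] -/
private theorem comap_toMonoidHom_eq_map_symm {A : Type*} {B : Type*} [CommMonoid A] [CommMonoid B]
    (f : A ≃* B) (K : Submonoid B) : K.comap f.toMonoidHom = K.map f.symm.toMonoidHom := by
  ext x
  rw [Submonoid.mem_comap, Submonoid.mem_map_equiv, MulEquiv.symm_symm]
  rfl

/-- **[Cor-36.iii.r17]** (Cor 3.6 (iii), p.100 l.105–108): `∞Ψ_{F_ξ}(†F_v) = (Ψ^×_{†C_v})_{⟨F_l^⋇⟩} · Im(ξ)^{ℚ≥0}`,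
`Im(ξ) = e⁻¹ ∘ ξ`, for abc-iut-L6-t2's `rootPowers` reading of `ξ^{ℚ≥0}` (the `∞`-companion of the statement
file's `frobenioidGaussianMonoid_eq`; slack B6 inherited). (IUTchII §3 Cor 3.6 (iii), kurims p.100) [claim: Mochizuki2012, status: disputed] -/
theorem inftyFrobenioidGaussianMonoid_eq (e : N ≃* M) (ξ : T → M) :
    inftyFrobenioidGaussianMonoid e ξ = inftyGaussianMonoid (fun t => e.symm (ξ t)) := by
  unfold inftyFrobenioidGaussianMonoid inftyGaussianMonoid
  rw [comap_toMonoidHom_eq_map_symm]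
  change (unitDiagonal T M ⊔ rootPowers ξ).map (piIso T e.symm).toMonoidHom = _
  rw [Submonoid.map_sup, map_piIso_unitDiagonal, rootPowers_map_mulEquiv]
  rfl

end Infty

/-! ### 5. [Cor-36.iii.r19] Monoid isomorphisms of split monoids respect the splittings up to torsion -/

section Splittings

variable {H : Type u} [CommGroup H] (U : Subgroup H) (θ : H)

/-- **Units of a split monoid.** If `θ` has infinite order modulo `U` (`θ^n ∈ U ⇒ n = 0`), the units OF
THE MONOID `U · θ^ℕ` are exactly the elements of `U` (Cor 3.6 (iii), p.100 l.99–105 with Prop 3.1 (i):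
the unit factor of a splitting up to torsion, paraphrase). (IUTchII §3 Cor 3.6 (iii), kurims p.100) [claim: Mochizuki2012, status: disputed] -/
theorem isUnit_splitMonoid_iff (hfree : ∀ n : ℕ, θ ^ n ∈ U → n = 0)
    (a : splitMonoid U (Submonoid.powers θ)) : IsUnit a ↔ (a : H) ∈ U := by
  constructor
  · intro ha
    obtain ⟨b, hab⟩ := ha.exists_right_inv
    obtain ⟨u, hu, _, ⟨n, rfl⟩, hua⟩ := (mem_splitMonoid_iff _ _ _).mp a.2
    obtain ⟨w, hw, _, ⟨m, rfl⟩, hwb⟩ := (mem_splitMonoid_iff _ _ _).mp b.2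
    dsimp only at hua hwb
    have h1 : (a : H) * (b : H) = 1 := by
      rw [← Submonoid.coe_mul, hab, Submonoid.coe_one]
    have h2 : (u * w) * θ ^ (n + m) = 1 := by
      rw [← h1, ← hua, ← hwb, pow_add]
      ac_rfl
    have hθ : θ ^ (n + m) ∈ U := by
      rw [eq_inv_of_mul_eq_one_right h2]
      exact U.inv_mem (U.mul_mem hu hw)
    have hn : n = 0 := by
      have := hfree _ hθ
      omega
    rw [← hua, hn, pow_zero, mul_one]
    exact hu
  · intro ha
    refine ⟨⟨a, ⟨(a : H)⁻¹, mem_thetaSplit_of_mem_units U θ (U.inv_mem ha)⟩, ?_, ?_⟩, rfl⟩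
    · exact Subtype.ext (mul_inv_cancel (a : H))
    · exact Subtype.ext (inv_mul_cancel (a : H))

variable {H' : Type v} [CommGroup H'] (U' : Subgroup H') (θ' : H')

/-- **[Cor-36.iii.r19]**, unit factors: a monoid isomorphism `Φ : U · θ^ℕ ⥲ U′ · θ′^ℕ` between split monoids
with generators of infinite order modulo the unit groups carries `U` EXACTLY onto `U′` (Cor 3.6 (iii)
p.100 l.110 – p.101 l.3, paraphrase: compatible with the splittings up to torsion of Prop 3.1 (i), Prop 3.3,
Cor 3.5 (iii) — applied to the Kummer isomorphism `kummerTheta α` of Prop 3.3 (i)).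
(IUTchII §3 Cor 3.6 (iii), kurims p.100) [claim: Mochizuki2012, status: disputed] -/
theorem splitMonoid_mulEquiv_mem_units_iff (hfree : ∀ n : ℕ, θ ^ n ∈ U → n = 0)
    (hfree' : ∀ n : ℕ, θ' ^ n ∈ U' → n = 0)
    (Φ : splitMonoid U (Submonoid.powers θ) ≃* splitMonoid U' (Submonoid.powers θ'))
    (a : splitMonoid U (Submonoid.powers θ)) :
    (a : H) ∈ U ↔ ((Φ a : splitMonoid U' (Submonoid.powers θ')) : H') ∈ U' := by
  rw [← isUnit_splitMonoid_iff U θ hfree, ← isUnit_splitMonoid_iff U' θ' hfree']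
  exact ⟨fun h => h.map Φ, fun h => by simpa using h.map Φ.symm⟩

/-- **[Cor-36.iii.r19]**, theta factors: such a `Φ` carries the generator `θ` into `U′ · θ′` — i.e. it
respects the splittings up to torsion (the quotients by the unit groups are both `(ℕ, +)`, and `Φ` matches
their generators). (IUTchII §3 Cor 3.6 (iii), kurims p.100) [claim: Mochizuki2012, status: disputed] -/
theorem splitMonoid_mulEquiv_generator (hfree : ∀ n : ℕ, θ ^ n ∈ U → n = 0)
    (hfree' : ∀ n : ℕ, θ' ^ n ∈ U' → n = 0)
    (Φ : splitMonoid U (Submonoid.powers θ) ≃* splitMonoid U' (Submonoid.powers θ')) :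
    ∃ u' ∈ U', ((Φ ⟨θ, theta_mem_thetaSplit U θ⟩ : splitMonoid U' (Submonoid.powers θ')) : H') =
      u' * θ' := by
  -- write `Φ θ = u' θ'^m` and `Φ⁻¹ θ' = u θ^n`
  set b := Φ ⟨θ, theta_mem_thetaSplit U θ⟩ with hb_def
  obtain ⟨u', hu', _, ⟨m, rfl⟩, hb⟩ := (mem_splitMonoid_iff _ _ _).mp b.2
  set a := Φ.symm ⟨θ', theta_mem_thetaSplit U' θ'⟩ with ha_def
  obtain ⟨u, hu, _, ⟨n, rfl⟩, ha⟩ := (mem_splitMonoid_iff _ _ _).mp a.2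
  dsimp only at hb ha
  -- `a = u · θ^n` inside the monoid
  have haA : a = ⟨u, mem_thetaSplit_of_mem_units U θ hu⟩ *
      ⟨θ, theta_mem_thetaSplit U θ⟩ ^ n := by
    apply Subtype.ext
    rw [Submonoid.coe_mul, SubmonoidClass.coe_pow]
    exact ha.symm
  -- the unit `u` goes to a unit
  have hw : ((Φ ⟨u, mem_thetaSplit_of_mem_units U θ hu⟩ : splitMonoid U' (Submonoid.powers θ')) : H')
      ∈ U' :=
    (splitMonoid_mulEquiv_mem_units_iff U θ U' θ' hfree hfree' Φ _).mp hu
  set w := ((Φ ⟨u, mem_thetaSplit_of_mem_units U θ hu⟩ : splitMonoid U' (Submonoid.powers θ')) : H')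
    with hw_def
  -- `θ' = Φ a = w · (u' θ'^m)^n`
  have hθ' : θ' = w * (u' * θ' ^ m) ^ n := by
    have h1 : (⟨θ', theta_mem_thetaSplit U' θ'⟩ : splitMonoid U' (Submonoid.powers θ')) = Φ a := by
      rw [ha_def, MulEquiv.apply_symm_apply]
    have h2 := congrArg Subtype.val h1
    rw [haA, map_mul, map_pow, Submonoid.coe_mul, SubmonoidClass.coe_pow] at h2
    change θ' = w * (b : H') ^ n at h2
    rw [← hb] at h2
    exact h2
  -- hence `θ'^(m n) = (w u'^n)⁻¹ θ'`, forcing `m n = 1`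
  have h3 : (w * u' ^ n) * θ' ^ (m * n) = θ' := by
    rw [pow_mul]
    conv_rhs => rw [hθ']
    rw [mul_pow]
    ac_rfl
  have hmn : m * n = 1 := by
    rcases Nat.eq_zero_or_pos (m * n) with h0 | hpos
    · exfalso
      rw [h0, pow_zero, mul_one] at h3
      have : θ' ^ 1 ∈ U' := by
        rw [pow_one, ← h3]
        exact U'.mul_mem hw (U'.pow_mem hu' n)
      exact one_ne_zero (hfree' 1 this)
    · obtain ⟨k, hk⟩ : ∃ k, m * n = k + 1 := ⟨m * n - 1, by omega⟩
      have h4 : θ' ^ k = (w * u' ^ n)⁻¹ := by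
        rw [hk, pow_succ, ← mul_assoc] at h3
        -- `(w u'^n) θ'^k θ' = θ'` ⇒ `(w u'^n) θ'^k = 1`
        have h5 : (w * u' ^ n) * θ' ^ k = 1 := mul_right_cancel (h3.trans (one_mul θ').symm)
        exact eq_inv_of_mul_eq_one_right h5
      have hkU : θ' ^ k ∈ U' := by
        rw [h4]
        exact U'.inv_mem (U'.mul_mem hw (U'.pow_mem hu' n))
      have hk0 : k = 0 := hfree' k hkU
      omega
  have hm : m = 1 := Nat.eq_one_of_mul_eq_one_right hmn
  refine ⟨u', hu', ?_⟩
  rw [← hb, hm, pow_one]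

end Splittings

/-! ### 6. [Cor-36.iii.r19] at abc-iut-L6-t2's types: the Kummer isomorphism `Ψ_{†F^Θ_v,α} ⥲ Ψ^ι_env` of
Prop 3.3 (i) respects the splittings up to torsion (v2 append) -/

section KummerSplitting

variable {P : Type u} [Group P] {E : TemperedThetaMonoids.ThetaEnvData.{u, v} P}
  {F : TemperedFrobenioidThetaData.{u, v} P} (K : Prop33KummerStatements E F)

/-- **[Cor-36.iii.r19] at the typed objects** (Cor 3.6 (iii), p.100 l.110 – p.101 l.3, paraphrase: the
splittings are compatible, relative to the isomorphisms of the third display, with the splittings up to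
torsion of Prop 3.1 (i), Prop 3.3 (i) [Ex 3.2], Cor 3.5 (iii)): abc-iut-L6-t2's REAL Kummer isomorphism
`kummerTheta α : Ψ_{†F^Θ_v,α} ⥲ Ψ^ι_env(M^Θ_*)` (`Prop33KummerStatements`) carries the unit group `O^×_{C^Θ_v}` EXACTLY onto
`M^×_TM` and the Frobenioid-theoretic theta function `Θ^α_v` into `M^×_TM · θ` for any representative
`θ ∈ θ^ι_env` — GIVEN that `θ^ι_env` is one `M^×_TM`-orbit (Cor 3.5 (ii) input `horb`, as in abc-iut-w4-d004's
`thetaMonoid_eq_splitMonoid_powers`) and that `Θ^α_v`, `θ` have infinite order modulo the unit groups (true at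
the model: positive valuation). Pure consequence of `splitMonoid_mulEquiv_mem_units_iff` /
`splitMonoid_mulEquiv_generator`; no property of `kummerTheta` beyond being a monoid isomorphism is used.
(IUTchII §3 Cor 3.6 (iii), kurims p.100) [claim: Mochizuki2012, status: disputed] -/
theorem kummerTheta_respects_splitting (α : P) {θ : E.H} (hθ : θ ∈ E.thetaEnv (K.label α))
    (horb : ∀ θ' ∈ E.thetaEnv (K.label α), ∃ u ∈ E.units, θ' = u * θ)
    (hfreeF : ∀ n : ℕ, (F.conj α F.theta) ^ n ∈ F.units → n = 0)
    (hfreeE : ∀ n : ℕ, θ ^ n ∈ E.units → n = 0) :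
    (∀ x : F.frobThetaMonoid α,
        (x : F.K) ∈ F.units ↔ ((K.kummerTheta α x : E.thetaMonoid (K.label α)) : E.H) ∈ E.units) ∧
      ∃ u ∈ E.units,
        ((K.kummerTheta α ⟨F.conj α F.theta, theta_mem_thetaSplit F.units (F.conj α F.theta)⟩ :
            E.thetaMonoid (K.label α)) : E.H) = u * θ := by
  have hS : E.thetaMonoid (K.label α) = splitMonoid E.units (Submonoid.powers θ) :=
    thetaMonoid_eq_splitMonoid_powers E hθ horb
  -- the Kummer isomorphism read onto the split presentation `M^×_TM · θ^ℕ`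
  let Φ : F.frobThetaMonoid α ≃* splitMonoid E.units (Submonoid.powers θ) :=
    (K.kummerTheta α).trans (MulEquiv.submonoidCongr hS)
  have hΦ : ∀ x : F.frobThetaMonoid α,
      ((Φ x : splitMonoid E.units (Submonoid.powers θ)) : E.H) =
        ((K.kummerTheta α x : E.thetaMonoid (K.label α)) : E.H) := fun x => rfl
  refine ⟨fun x => ?_, ?_⟩
  · rw [← hΦ]
    exact splitMonoid_mulEquiv_mem_units_iff F.units (F.conj α F.theta) E.units θ hfreeF hfreeE Φ x
  · obtain ⟨u, hu, h⟩ := splitMonoid_mulEquiv_generator F.units (F.conj α F.theta) E.units θ hfreeF hfreeE Φ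
    exact ⟨u, hu, by rw [← hΦ]; exact h⟩

end KummerSplitting

end BadPrimeGaussianMonoids

end Literature.IUT.HodgeArakelov
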